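import Mathlib
import Summits.Ventures.PercRepro2.Defs
import Summits.Ventures.PercRepro2.Independence
import Summits.Ventures.PercRepro2.Harris
import Summits.Ventures.PercRepro2.Graph
import Summits.Ventures.PercRepro2.Exploration
import Summits.Ventures.PercRepro2.Induced
import Summits.Ventures.PercRepro2.HubModel
import Summits.Ventures.PercRepro2.HubLaw
import Summits.Ventures.PercRepro2.HubModel3
import Summits.Ventures.PercRepro2.HubLaw3
import Summits.Ventures.PercRepro2.HubPat3

/-!
# The inner law of the a₃-hub: atoms, total mass, and the Harris slacks (blind cell PercRepro2,
mine-2 g16; MINE2-A3FIRST.md §3, §8.2 — the R₃ analogue of typer-1's `HubHarris.lean`)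

The inner pattern `innerPat3` (which of the six pairs of `o, a₁, a₂, b` are connected in
`G′ = G − a₃`) is monotone in the configuration (`innerPat3_mono`), so the event of a monotone
pattern predicate is an up-set (`isUpperSet_patEvent3`) and Harris–FKG applies. The fifteen
consistent patterns are listed as `atomPat3` in the order of the hub table `hub3_W.txt`
(`x 0 = oa₁a₂b, x 1 = oa₁a₂|b, …, x 14 = o|a₁|a₂|b`; `consistent_iff_atom`), the inner masses
`innerMass3 p ends μ a = P(Π = atomPat3 a)` sum to one (`sum_innerMass3`), and every **Harris
slack** `Hslack3 E₁ E₂ m = P(U_{E₁} ∩ U_{E₂}) · S − P(U_{E₁}) · P(U_{E₂})` of two up-sets of the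
partition lattice (given as sets of atom indices) is nonnegative (`Hslack3_nonneg`); the 44
Harris pairs used by the 66 certificates of `HubCert3Part1–6.lean` (up-sets by `decide`) are instantiated as
`harris_block_0 … harris_block_43`.
-/

namespace Summit.Ventures.PercRepro2.Hub3

open Hub

variable {V : Type*} {E : Type*}

section Monotone

variable {ends : E → Sym2 V} {μ : Mark → V}

/-- The inner configuration is monotone. -/
lemma innerConfig3_mono {ω ω' : Config E} (h : ω ≤ ω') :
    innerConfig3 ends μ ω ≤ innerConfig3 ends μ ω' := by
  intro e
  by_cases he : e ∈ touches ends {μ .a₃}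
  · rw [innerConfig3, innerConfig3, delConfig_apply_of_mem he, delConfig_apply_of_mem he]
  · rw [innerConfig3, innerConfig3, delConfig_apply_of_notMem he, delConfig_apply_of_notMem he]
    exact h e

open Classical in
/-- A bit of the inner pattern is a connection in `G′`. -/
lemma innerPat3_eq_true_iff (ω : Config E) (i : Fin 6) :
    innerPat3 ends μ ω i = true ↔
      Conn ends (innerConfig3 ends μ ω) (μ (ipair3 i).1) (μ (ipair3 i).2) := by
  unfold innerPat3
  exact decide_eq_true_iff

/-- **The inner pattern is monotone** in the configuration. -/
lemma innerPat3_mono {ω ω' : Config E} (h : ω ≤ ω') (i : Fin 6)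
    (hi : innerPat3 ends μ ω i = true) : innerPat3 ends μ ω' i = true := by
  rw [innerPat3_eq_true_iff] at hi ⊢
  exact conn_mono (innerConfig3_mono h) hi

/-- The event of a monotone pattern predicate is an up-set. -/
lemma isUpperSet_patEvent3 (U : (Fin 6 → Bool) → Bool)
    (hU : ∀ π π', (∀ i, π i = true → π' i = true) → U π = true → U π' = true) :
    IsUpperSet {ω : Config E | U (innerPat3 ends μ ω) = true} := by
  intro ω ω' h hω
  exact hU _ _ (fun i hi => innerPat3_mono h i hi) hω

end Monotone

section Atoms

/-- The fifteen consistent patterns — the set partitions of `(o, a₁, a₂, b)` — in the order of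
the hub table (`hub3_w.c`): bits `(oa₁, oa₂, ob, a₁a₂, a₁b, a₂b)`. -/
def atomPat3 : Fin 15 → (Fin 6 → Bool) :=
  ![![true, true, true, true, true, true],
    ![true, true, false, true, false, false],
    ![true, false, true, false, true, false],
    ![true, false, false, false, false, true],
    ![true, false, false, false, false, false],
    ![false, true, true, false, false, true],
    ![false, true, false, false, true, false],
    ![false, true, false, false, false, false],
    ![false, false, true, true, false, false],
    ![false, false, false, true, true, true],
    ![false, false, false, true, false, false],
    ![false, false, true, false, false, false],
    ![false, false, false, false, true, false],
    ![false, false, false, false, false, true],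
    ![false, false, false, false, false, false]]

/-- `atomPat3` is injective. -/
lemma atomPat3_injective : Function.Injective atomPat3 := by
  intro a b h
  revert a b
  decide

/-- The consistent patterns are exactly the atoms. -/
lemma consistent_iff_atom (π : Fin 6 → Bool) : Consistent π ↔ ∃ a, atomPat3 a = π := by
  revert π
  decide

/-- The indicator of a set of atoms. -/
def iu3 (S : Finset (Fin 15)) (a : Fin 15) : ℤ := if a ∈ S then 1 else 0

/-- The up-set predicate generated by a set of atoms: some atom of `S` lies below `π` bitwise
(monotone in `π` for every `S`). -/
def upPred (S : Finset (Fin 15)) (π : Fin 6 → Bool) : Bool :=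
  decide (∃ a ∈ S, ∀ i, atomPat3 a i = true → π i = true)

/-- `upPred S` is monotone. -/
lemma upPred_mono (S : Finset (Fin 15)) (π π' : Fin 6 → Bool)
    (h : ∀ i, π i = true → π' i = true) (hπ : upPred S π = true) : upPred S π' = true := by
  unfold upPred at hπ ⊢
  rw [decide_eq_true_iff] at hπ ⊢
  obtain ⟨a, ha, hab⟩ := hπ
  exact ⟨a, ha, fun i hi => h i (hab i hi)⟩

/-- A set of atoms is an up-set of the partition lattice: closed under coarsening (bitwise `≤`). -/
def IsUp (S : Finset (Fin 15)) : Prop :=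
  ∀ a ∈ S, ∀ b : Fin 15, (∀ i, atomPat3 a i = true → atomPat3 b i = true) → b ∈ S

/-- Being an up-set is decidable (a finite check on the 15 atoms). -/
instance : DecidablePred IsUp := fun S => by unfold IsUp; infer_instance

/-- `upPred` at an atom is membership, for an up-set. -/
lemma upPred_atom (S : Finset (Fin 15)) (hS : IsUp S) (b : Fin 15) :
    upPred S (atomPat3 b) = decide (b ∈ S) := by
  unfold upPred
  rw [decide_eq_decide]
  constructor
  · rintro ⟨a, ha, hab⟩
    exact hS a ha b hab
  · intro hb
    exact ⟨b, hb, fun i hi => hi⟩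

end Atoms

section Masses

variable [Fintype E] [DecidableEq E] {R : Type*} [CommRing R] {ends : E → Sym2 V} {μ : Mark → V}

/-- The inner masses `m_a = P(Π = atomPat3 a)`. -/
noncomputable def innerMass3 (p : E → R) (ends : E → Sym2 V) (μ : Mark → V) : Fin 15 → R :=
  fun a => prob p {ω | innerPat3 ends μ ω = atomPat3 a}

/-- A sum over all patterns of a function vanishing off the atoms is a sum over the atoms. -/
lemma sum_atoms3 (g : (Fin 6 → Bool) → R) (hg : ∀ π, ¬ Consistent π → g π = 0) :
    ∑ π, g π = ∑ a, g (atomPat3 a) := by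
  classical
  rw [← Finset.sum_image (f := g) (s := Finset.univ) (g := atomPat3)
    (fun a _ b _ h => atomPat3_injective h)]
  symm
  apply Finset.sum_subset (Finset.subset_univ _)
  intro π _ hπ
  apply hg
  rw [consistent_iff_atom]
  rintro ⟨a, ha⟩
  exact hπ (Finset.mem_image.mpr ⟨a, Finset.mem_univ a, ha⟩)

/-- The probability of a pattern event as a sum over the atoms. -/
lemma prob_patEvent3 (p : E → R) (U : (Fin 6 → Bool) → Bool) :
    prob p {ω | U (innerPat3 ends μ ω) = true} =
      ∑ a, if U (atomPat3 a) then innerMass3 p ends μ a else 0 := by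
  classical
  rw [prob_eq_sum_fiber p (innerPat3 ends μ)]
  have h : ∀ π : Fin 6 → Bool, prob p ({ω | U (innerPat3 ends μ ω) = true} ∩ {ω | innerPat3 ends μ ω = π}) =
      if U π then prob p {ω | innerPat3 ends μ ω = π} else 0 := by
    intro π
    by_cases hU : U π = true
    · rw [if_pos hU]
      congr 1
      ext ω
      simp only [Set.mem_inter_iff, Set.mem_setOf_eq]
      exact ⟨fun h => h.2, fun h => ⟨by rw [h]; exact hU, h⟩⟩
    · rw [if_neg hU]
      convert prob_empty p
      ext ω
      simp only [Set.mem_inter_iff, Set.mem_setOf_eq, Set.mem_empty_iff_false, iff_false, not_and]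
      intro h1 h2
      rw [h2] at h1
      exact hU h1
  simp only [h]
  exact sum_atoms3 _ fun π hπ => by
    rw [prob_innerPat3_eq_zero_of_not_consistent p hπ]
    simp

/-- **The inner masses sum to one.** -/
theorem sum_innerMass3 (p : E → R) : ∑ a, innerMass3 p ends μ a = 1 := by
  have h := prob_patEvent3 (ends := ends) (μ := μ) p (fun _ => true)
  simp only [if_true] at h
  rw [← h]
  convert prob_univ p
  ext ω
  simp

end Masses

section Harris

variable [Fintype E] [DecidableEq E] {R : Type*} [CommRing R] [LinearOrder R] [IsStrictOrderedRing R]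
  {ends : E → Sym2 V} {μ : Mark → V}

/-- The Harris slack of two sets of atoms: `P(U₁ ∩ U₂) · S − P(U₁) · P(U₂)` in the masses. -/
def Hslack3 (E₁ E₂ : Finset (Fin 15)) (m : Fin 15 → R) : R :=
  (∑ a, (iu3 E₁ a : R) * iu3 E₂ a * m a) * (∑ b, m b) -
    (∑ a, (iu3 E₁ a : R) * m a) * (∑ b, (iu3 E₂ b : R) * m b)

/-- **The Harris slacks of the inner law are nonnegative** for monotone up-set predicates. -/
theorem Hslack3_nonneg (p : E → R) (hp : IsProbVec p) (E₁ E₂ : Finset (Fin 15))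
    (h₁ : IsUp E₁) (h₂ : IsUp E₂) :
    0 ≤ Hslack3 E₁ E₂ (innerMass3 p ends μ) := by
  have hH := prob_mul_prob_le_prob_inter hp
    (isUpperSet_patEvent3 (ends := ends) (μ := μ) (upPred E₁) (upPred_mono E₁))
    (isUpperSet_patEvent3 (ends := ends) (μ := μ) (upPred E₂) (upPred_mono E₂))
  have hinter : {ω : Config E | upPred E₁ (innerPat3 ends μ ω) = true} ∩
      {ω | upPred E₂ (innerPat3 ends μ ω) = true} =
      {ω | (upPred E₁ (innerPat3 ends μ ω) && upPred E₂ (innerPat3 ends μ ω)) = true} := by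
    ext ω
    simp [Bool.and_eq_true]
  rw [hinter, prob_patEvent3 p (upPred E₁), prob_patEvent3 p (upPred E₂),
    prob_patEvent3 p (fun π => upPred E₁ π && upPred E₂ π)] at hH
  unfold Hslack3
  rw [sum_innerMass3, mul_one]
  have e1 : ∀ S : Finset (Fin 15), IsUp S → (∑ a, (iu3 S a : R) * innerMass3 p ends μ a) =
      ∑ a, if upPred S (atomPat3 a) then innerMass3 p ends μ a else 0 := by
    intro S hS
    refine Finset.sum_congr rfl fun a _ => ?_
    rw [upPred_atom S hS]
    unfold iu3
    split_ifs <;> simp_all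
  have e2 : (∑ a, (iu3 E₁ a : R) * iu3 E₂ a * innerMass3 p ends μ a) =
      ∑ a, if (upPred E₁ (atomPat3 a) && upPred E₂ (atomPat3 a)) then innerMass3 p ends μ a else 0 := by
    refine Finset.sum_congr rfl fun a _ => ?_
    rw [upPred_atom E₁ h₁, upPred_atom E₂ h₂]
    unfold iu3
    split_ifs <;> simp_all
  rw [e1 E₁ h₁, e1 E₂ h₂, e2]
  linarith

end Harris

end Summit.Ventures.PercRepro2.Hub3
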